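import Summits.Parity.GeneralizedHardyLittlewood.Theses.ZDegreeToeplitzBand
import Literature.NumberTheory.LFunctions.Zhang2022.KnifeEdgeLenZDegreeConversion

/-! POST-OPEN VARIANT v3 of the BIRTH SKELETON (BC3) — v3 (author hand ls-knife-len-idea-1 g4, from typer-1 g4 v2): EXACTLY ONE theorem concludes the crux, the hypothesis-free `<Crux>_of : <Crux>` proved from the `stub_*` BY NAME (v2 also had a hypothesis-form `<Crux>_comp` concluding the crux; `#h21_check_skeleton` takes «the first theorem concluding the crux» in environment order and picked `_comp` on 2 of 3 files ⇒ `skeleton.extra-hypothesis`); shape rule ls-lead 04:15:07Z; critic ls-knife-crit-1 g3 probe lineage: imports the opened route module, drops the local def copy.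
ORIGINAL HEADER: for route `ZDegreeToeplitzBand` — statements only; sorries ONLY inside `stub_*`.
The programme SEARCHES and TYPES; no claim about Landau–Siegel zeros, Theorems 1–2 of arXiv:2211.02515 or a repaired
Margin232 until a kernel theorem says so. -/

namespace Summit.Parity.GeneralizedHardyLittlewood.Theses.ZDegreeToeplitzBand

open Literature.NumberTheory.LFunctions.Zhang2022

-- (post-open: `PsiGradedTables` is now the TREE decl; local copy dropped)

/-- stub 1 · the ψ-graded degree-1 CROSS table has a main-term functional, eventually in c′ (Zhang §8–9-type derivation,
unit Z(ρ,ψ): reflection + exact expansion on σ = 3/2 + one Gauss sum + reciprocity; F2 note §1–2, e = 1 / Kl₂ halves). -/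
theorem stub_crossPsi :
    ∃ c₀ : ℝ, ∀ c' : ℝ, c₀ ≤ c' → ∃ X₁ : KnifeEdge.PairFunctional, KnifeEdge.CrossTablePsi c' 1 X₁ := by
  sorry

/-- stub 2 · the ψ-graded degree-1 DUAL table (two Q-blocks) has a main-term functional, eventually in c′. -/
theorem stub_dualPsi :
    ∃ c₀ : ℝ, ∀ c' : ℝ, c₀ ≤ c' → ∃ Y₁ : KnifeEdge.PairFunctional, KnifeEdge.DualCrossTablePsi c' 1 Y₁ := by
  sorry

/-- stub 3 · the NEW degree-2 table τ₂ in the tree's TYPED K1″a/K1″b split (p487998): eventually in c′ there are split tables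
T_diag, T_wrap and a functional X₂ with `CrossMeanSplit c′ 2 T_diag T_wrap` (exact bookkeeping: reflection + right edge + family Gauss
moment `familyGaussMoment_holds` + reciprocity), `DiagMain T_diag X₂` (K1″a: the h·n = r family carries X₂(f,g)·𝔞𝔓) and
`WrapNegligible T_wrap` (K1″b: the Kl₃ wrap cancels — KowalskiMichelSawin2017 / FKM2014 box-wise). HARDEST (L; XL if pointwise). The
∃ is discharged by CONSTRUCTION (items α1/α2-deg2 of the route: explicit closed forms), not by choice. -/
theorem stub_tauTwoSplit :
    ∃ c₀ : ℝ, ∀ c' : ℝ, c₀ ≤ c' → ∃ (Tdiag Twrap : KnifeEdge.PieceDTable) (X₂ : KnifeEdge.PairFunctional),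
      KnifeEdge.CrossMeanSplit c' 2 Tdiag Twrap ∧ KnifeEdge.DiagMain Tdiag X₂ ∧ KnifeEdge.WrapNegligible Twrap := by
  sorry

/-- **`PsiGradedTables_of : PsiGradedTables`** — the ONLY theorem in this file concluding the crux (v3: the
hypothesis-form composition `_comp` of v2 is folded into this proof, because `#h21_check_skeleton` takes «the first
theorem concluding the crux» in environment order — with two such theorems the pick is not deterministic and v2
failed `skeleton.extra-hypothesis` on 2 of 3 files in a scratch audit). Stubs consumed BY NAME; tree glue
`KnifeEdge.tauTwoTablePsi_of_split`. -/
theorem PsiGradedTables_of : PsiGradedTables := by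
  obtain ⟨c₁, h₁⟩ := stub_crossPsi
  obtain ⟨c₂, h₂⟩ := stub_dualPsi
  obtain ⟨c₃, h₃⟩ := stub_tauTwoSplit
  refine ⟨max c₁ (max c₂ c₃), fun c' hc' => ?_⟩
  obtain ⟨X₁, t1⟩ := h₁ c' (le_trans (le_max_left _ _) hc')
  obtain ⟨Y₁, t21⟩ := h₂ c' (le_trans (le_trans (le_max_left _ _) (le_max_right _ _)) hc')
  obtain ⟨Tdiag, Twrap, X₂, hs, hd, hw⟩ := h₃ c' (le_trans (le_trans (le_max_right _ _) (le_max_right _ _)) hc')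
  exact ⟨X₁, Y₁, X₂, t1, t21, KnifeEdge.tauTwoTablePsi_of_split hs hd hw⟩

end Summit.Parity.GeneralizedHardyLittlewood.Theses.ZDegreeToeplitzBand
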